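import Mathlib
import Summits.Ventures.PercRepro.TriangleCapThirdBestLocus

/-!
# PercRepro — THE PAIR-COUNT TRICHOTOMY AND THE FOURTH-BEST VALUE OF THE `K₄⁻`-FREE CHERRY TABLE (p3, gen 50;
part 211)

THE TRICHOTOMY (`pair_count_trichotomy`): a triangle-free graph with `s ≥ 4` edges has `Σ_v d(v)²` equal to the star
value `s (s + 1)`, or to the broom value `s (s + 1) − 2 (s − 2)`, or to the star-plus-pair value `s (s + 1) − 2 (s − 1)`,
or at most `s (s + 1) − 4 (s − 3)` — there is NOTHING in between: with `w` of maximum degree `Δ`, `Δ = s` is the star,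
`Δ ≤ s − 2` is the max-degree stability (§10cc), and `Δ = s − 1` leaves one edge `e` off `w`: an end of `e` adjacent
to `w` pins the value at the broom value from both sides (`sum_deg_sq_ge_of_adj` and `sum_deg_sq_le_of_not_star`),
no such end gives the star-plus-pair value (`sum_deg_sq_of_star_plus_pair`).  On the `a`-bipartite class of the cell
this is `bipSub_gap_trichotomy`: the gap to the closed form is `0`, `2 (r − 2)`, `2 (r − 1)`, or `≥ 4 (r − 3)`.

THE FOURTH-BEST VALUE (`cherry_fourth_best`): on every cell `r ≥ 6` of every row `a ≥ 3` a `K₄⁻`-free graph at none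
of the three top values is at least `min (4 (r − 3)) (stabGapFull k a r)` below the closed form, and the value is
attained — by the DOUBLE BROOM `twoPairsAtLeaf` (`K_{a,k−a}` minus an `(r − 2)`-star at `0` minus the two pairs
`{1, a}`, `{2, a}` at the leaf `a` of the star; `Σ d²` drops by `2 k − 2` and then `2 k − 4`) when `4 (r − 3) ≤
stabGapFull k a r`, and by the non-bipartite witness of the stability table otherwise.

Axioms: standard.
-/

namespace PercRepro

namespace TriangleCap

namespace C047

open Finset

variable {V : Type*} [Fintype V] [DecidableEq V]

/-- **THE PAIR-COUNT TRICHOTOMY:** a triangle-free graph with `s ≥ 4` edges has `Σ_v d(v)²` equal to `s (s + 1)`, or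
to `s (s + 1) − 2 (s − 2)`, or to `s (s + 1) − 2 (s − 1)`, or at most `s (s + 1) − 4 (s − 3)`. -/
theorem pair_count_trichotomy (H : SimpleGraph V) [DecidableRel H.Adj] (hfree : H.CliqueFree 3) (s : ℕ)
    (hs : 4 ≤ s) (hm : H.edgeFinset.card = s) :
    ∑ v, deg H v * deg H v = s * (s + 1) ∨ ∑ v, deg H v * deg H v + 2 * (s - 2) = s * (s + 1) ∨
      ∑ v, deg H v * deg H v + 2 * (s - 1) = s * (s + 1) ∨ ∑ v, deg H v * deg H v + 4 * (s - 3) ≤ s * (s + 1) := by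
  have hne : (univ : Finset V).Nonempty := by
    obtain ⟨e, he⟩ := card_pos.mp (by omega : 0 < H.edgeFinset.card)
    revert he
    refine Sym2.ind (fun x y _ => ?_) e
    exact ⟨x, mem_univ x⟩
  obtain ⟨w, -, hwmax⟩ := exists_max_image univ (deg H) hne
  have hwle : deg H w ≤ H.edgeFinset.card := by
    rw [deg_eq_degree, ← SimpleGraph.card_incidenceFinset_eq_degree]
    exact card_le_card (H.incidenceFinset_subset w)
  rcases lt_trichotomy (deg H w + 1) s with hlt | heq | hgt
  · right; right; right
    have hΔ : ∀ v, deg H v + 2 ≤ H.edgeFinset.card := fun v => by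
      have := hwmax v (mem_univ v)
      omega
    have := sum_deg_sq_le_of_maxdeg H hfree (by omega) hΔ
    rw [hm] at this
    exact this
  · obtain ⟨e, he, hwe⟩ := exists_edge_not_mem H w (by omega)
    have hall := mem_of_ne_of_deg_eq_pred H w (by omega) e he hwe
    by_cases hend : ∀ u ∈ e, ¬ H.Adj w u
    · right; right; left
      have := sum_deg_sq_of_star_plus_pair H w (by omega) e he hwe hend hall
      rw [hm] at this
      exact this
    · right; left
      obtain ⟨u, hu, hadj⟩ : ∃ u ∈ e, H.Adj w u := by
        by_contra h
        exact hend (fun u hu hadj => h ⟨u, hu, hadj⟩)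
      obtain ⟨v, rfl⟩ := Sym2.mem_iff_exists.mp hu
      have huv : H.Adj u v := (SimpleGraph.mem_edgeSet H).mp (SimpleGraph.mem_edgeFinset.mp he)
      have hwv : w ≠ v := fun h => hwe (h ▸ Sym2.mem_mk_right u v)
      have hu2 : 2 ≤ deg H u := two_le_deg_of_adj_adj H u w v hwv hadj.symm huv
      have h1 := sum_deg_sq_ge_of_adj H w u (by omega) hadj hu2
      have h2 := sum_deg_sq_le_of_not_star H hfree (by omega)
        (fun v => exists_edge_not_mem H v (by have := hwmax v (mem_univ v); omega))
      rw [hm] at h1 h2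
      omega
  · left
    have hwr : deg H w = H.edgeFinset.card := by omega
    have := sum_deg_sq_eq_of_deg_eq_card H w hwr
    rw [hm] at this
    exact this

/-- **THE GAP TRICHOTOMY ON THE BIPARTITE CLASS:** for `D ≤ K(A, Aᶜ)`, `|A| = a`, `m + r = a (k − a)`, `r ≥ 4`,
`r + 1 ≤ k`, the gap of `D` to the closed form is `0`, `2 (r − 2)`, `2 (r − 1)`, or at least `4 (r − 3)`. -/
theorem bipSub_gap_trichotomy (D : SimpleGraph V) [DecidableRel D.Adj] (A : Finset V) (hD : BipSub D A) (a r : ℕ)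
    (hA : A.card = a) (hm : D.edgeFinset.card + r = a * (Fintype.card V - a)) (hr : 4 ≤ r)
    (hk : r + 1 ≤ Fintype.card V) :
    ∑ v, deg D v * deg D v + r * (Fintype.card V - 1 - r) = D.edgeFinset.card * Fintype.card V ∨
      ∑ v, deg D v * deg D v + r * (Fintype.card V - 1 - r) + 2 * (r - 2) = D.edgeFinset.card * Fintype.card V ∨
      ∑ v, deg D v * deg D v + r * (Fintype.card V - 1 - r) + 2 * (r - 1) = D.edgeFinset.card * Fintype.card V ∨
      ∑ v, deg D v * deg D v + r * (Fintype.card V - 1 - r) + 4 * (r - 3) ≤ D.edgeFinset.card * Fintype.card V := by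
  have hH := bipSub_sum_deg_sq_add_disjEdgePairs D A hD a r hA hm hk
  have hr' : (missingGraph D A).edgeFinset.card = r := card_edges_missingGraph D A hD a r hA hm
  have hid := sum_deg_sq_add_disjEdgePairs (missingGraph D A)
  rw [hr'] at hid
  have ht := pair_count_trichotomy (missingGraph D A) (cliqueFree_of_bipSub _ A (bipSub_missingGraph D A)) r hr hr'
  rcases ht with h | h | h | h
  · left; omega
  · right; left; omega
  · right; right; left; omega
  · right; right; right; omega

/-- **THE DOUBLE BROOM** on `Fin n`: `K_{a,n−a}` minus an `(r − 2)`-star at the vertex `0` of the small side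
(`bipMinusStar n a (r − 2)`, leaves `a, …, a + r − 3`) minus the two pairs `{1, a}` and `{2, a}` at the leaf `a`. -/
abbrev twoPairsAtLeaf (n a r : ℕ) (h1 : 1 < n) (h2 : 2 < n) (ha : a < n) : SimpleGraph (Fin n) :=
  delEdge (delEdge (bipMinusStar n a (r - 2)) ⟨1, h1⟩ ⟨a, ha⟩) ⟨2, h2⟩ ⟨a, ha⟩

/-- The arithmetic of the double broom: `S₀ + (r − 2)(n − 1 − (r − 2)) = E₀ n`, `E₂ + 2 = E₀`, `S₁ + 2 (n − 1) = S₀ + 2`,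
`S₂ + 2 (n − 2) = S₁ + 2` give `S₂ + r (n − 1 − r) + 4 (r − 3) = E₂ n`. -/
theorem twoPairsAtLeaf_arith (n r E₀ E₂ S₀ S₁ S₂ : ℕ) (hr : 3 ≤ r) (hn : r + 1 ≤ n)
    (hS0 : S₀ + (r - 2) * (n - 1 - (r - 2)) = E₀ * n) (hE : E₂ + 2 = E₀)
    (hS1 : S₁ + 2 * (n - 1) = S₀ + 2) (hS2 : S₂ + 2 * (n - 2) = S₁ + 2) :
    S₂ + r * (n - 1 - r) + 4 * (r - 3) = E₂ * n := by
  obtain ⟨r', rfl⟩ : ∃ r', r = r' + 3 := ⟨r - 3, by omega⟩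
  obtain ⟨t, rfl⟩ : ∃ t, n = r' + 4 + t := ⟨n - (r' + 4), by omega⟩
  subst hE
  have e1 : r' + 3 - 2 = r' + 1 := by omega
  have e2 : r' + 4 + t - 1 - (r' + 1) = t + 2 := by omega
  have e3 : r' + 4 + t - 1 - (r' + 3) = t := by omega
  have e4 : r' + 3 - 3 = r' := by omega
  have e5 : r' + 4 + t - 1 = r' + 3 + t := by omega
  have e6 : r' + 4 + t - 2 = r' + 2 + t := by omega
  rw [e1, e2] at hS0
  rw [e5] at hS1
  rw [e6] at hS2
  rw [e3, e4]
  zify at hS0 hS1 hS2 ⊢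
  linear_combination hS0 + hS1 + hS2

/-- **THE DOUBLE BROOM ATTAINS `closed − 4 (r − 3)`:** for `3 ≤ a`, `3 ≤ r`, `a + r ≤ n + 1`, `r + 1 ≤ n`, it is
`K₄⁻`-free, has `a (n − a) − r` edges and `Σ_v d(v)² + r (n − 1 − r) + 4 (r − 3) = m n`. -/
theorem twoPairsAtLeaf_value (n a r : ℕ) (ha3 : 3 ≤ a) (hr3 : 3 ≤ r) (han : a + r ≤ n + 1) (hn : r + 1 ≤ n) :
    K4mFree (twoPairsAtLeaf n a r (by omega) (by omega) (by omega)) ∧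
      (twoPairsAtLeaf n a r (by omega) (by omega) (by omega)).edgeFinset.card + r = a * (n - a) ∧
      ∑ v, deg (twoPairsAtLeaf n a r (by omega) (by omega) (by omega)) v *
          deg (twoPairsAtLeaf n a r (by omega) (by omega) (by omega)) v + r * (n - 1 - r) + 4 * (r - 3) =
        (twoPairsAtLeaf n a r (by omega) (by omega) (by omega)).edgeFinset.card * n := by
  have h1 : 1 < n := by omega
  have h2 : 2 < n := by omega
  have ha : a < n := by omega
  -- the two deleted pairs are edges
  have hadj1 : (bipMinusStar n a (r - 2)).Adj ⟨1, h1⟩ ⟨a, ha⟩ := by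
    rw [bipMinusStar_adj]
    simp only
    exact ⟨Or.inl ⟨by omega, by omega⟩, by omega⟩
  have hadj2 : (bipMinusStar n a (r - 2)).Adj ⟨2, h2⟩ ⟨a, ha⟩ := by
    rw [bipMinusStar_adj]
    simp only
    exact ⟨Or.inl ⟨by omega, by omega⟩, by omega⟩
  have hadj2' : (delEdge (bipMinusStar n a (r - 2)) ⟨1, h1⟩ ⟨a, ha⟩).Adj ⟨2, h2⟩ ⟨a, ha⟩ := by
    rw [delEdge_adj]
    refine ⟨hadj2, ?_⟩
    simp only [Fin.mk.injEq]
    omega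
  -- the degrees of the ends in `bipMinusStar n a (r − 2)`
  have hd1 : deg (bipMinusStar n a (r - 2)) ⟨1, h1⟩ = n - a :=
    deg_bipMinusStar_one_row n a (r - 2) (by omega) (by omega)
  have hda : deg (bipMinusStar n a (r - 2)) ⟨a, ha⟩ = a - 1 := by
    rw [deg_bipMinusStar n a (r - 2) (by omega) (by omega)]
    rw [if_neg (by simp only; omega), if_pos (by
      unfold rightStar
      simp only [mem_filter, mem_univ, true_and]
      omega)]
  have hd2 : deg (bipMinusStar n a (r - 2)) ⟨2, h2⟩ = n - a := by
    rw [deg_bipMinusStar n a (r - 2) (by omega) (by omega)]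
    rw [if_neg (by simp only; omega), if_neg (by
      unfold rightStar
      simp only [mem_filter, mem_univ, true_and]
      omega)]
    exact deg_bip_of_lt n a (by omega) _ (by simp only; omega)
  -- the degrees of the ends after the first deletion
  have hd2' : deg (delEdge (bipMinusStar n a (r - 2)) ⟨1, h1⟩ ⟨a, ha⟩) ⟨2, h2⟩ = n - a := by
    have := deg_delEdge (bipMinusStar n a (r - 2)) hadj1 ⟨2, h2⟩
    rw [if_neg (by simp only [Fin.mk.injEq]; omega)] at this
    omega
  have hda' : deg (delEdge (bipMinusStar n a (r - 2)) ⟨1, h1⟩ ⟨a, ha⟩) ⟨a, ha⟩ = a - 2 := by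
    have := deg_delEdge (bipMinusStar n a (r - 2)) hadj1 ⟨a, ha⟩
    rw [if_pos (Or.inr rfl)] at this
    omega
  -- the counts
  have hS0 := sum_deg_sq_bipMinusStar n a (r - 2) (by omega) (by omega) (by omega)
  rw [Fintype.card_fin] at hS0
  have hE0 := card_edges_bipMinusStar n a (r - 2) (by omega) (by omega)
  have hE1 := card_edges_delEdge (bipMinusStar n a (r - 2)) hadj1
  have hE2 := card_edges_delEdge (delEdge (bipMinusStar n a (r - 2)) ⟨1, h1⟩ ⟨a, ha⟩) hadj2'
  have hS1 := sum_deg_sq_delEdge (bipMinusStar n a (r - 2)) hadj1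
  rw [hd1, hda] at hS1
  have hS2 := sum_deg_sq_delEdge (delEdge (bipMinusStar n a (r - 2)) ⟨1, h1⟩ ⟨a, ha⟩) hadj2'
  rw [hd2', hda'] at hS2
  have e1 : n - a + (a - 1) = n - 1 := by omega
  have e2 : n - a + (a - 2) = n - 2 := by omega
  rw [e1] at hS1
  rw [e2] at hS2
  refine ⟨?_, ?_, ?_⟩
  · exact k4mFree_of_le _ _ (delEdge_le _ _ _)
      (k4mFree_of_le _ _ (delEdge_le _ _ _) (k4mFree_bipMinusStar n a (r - 2)))
  · show (delEdge (delEdge (bipMinusStar n a (r - 2)) ⟨1, h1⟩ ⟨a, ha⟩) ⟨2, h2⟩ ⟨a, ha⟩).edgeFinset.card + r =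
      a * (n - a)
    omega
  · show ∑ v, deg (delEdge (delEdge (bipMinusStar n a (r - 2)) ⟨1, h1⟩ ⟨a, ha⟩) ⟨2, h2⟩ ⟨a, ha⟩) v *
        deg (delEdge (delEdge (bipMinusStar n a (r - 2)) ⟨1, h1⟩ ⟨a, ha⟩) ⟨2, h2⟩ ⟨a, ha⟩) v +
        r * (n - 1 - r) + 4 * (r - 3) =
      (delEdge (delEdge (bipMinusStar n a (r - 2)) ⟨1, h1⟩ ⟨a, ha⟩) ⟨2, h2⟩ ⟨a, ha⟩).edgeFinset.card * n
    exact twoPairsAtLeaf_arith n r _ _ _ _ _ hr3 hn hS0 (by omega) hS1 hS2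

/-- **THE FOURTH-BEST VALUE OF THE CHERRY TABLE:** on every cell `(k, a, r)` with `3 ≤ a`, `6 ≤ r`, `2 a + r ≤ k`
(`r + 7 ≤ k` on the row `a = 3`), every `K₄⁻`-free graph with `a (k − a) − r` edges whose `Σ_v d(v)²` is none of the
three top values (closed, `closed − 2 (r − 2)`, `closed − 2 (r − 1)`) satisfies
`Σ_v d(v)² + r (k − 1 − r) + min (4 (r − 3)) (stabGapFull k a r) ≤ m k`, and the value is attained (the double broom
when `4 (r − 3) ≤ stabGapFull k a r`, the non-bipartite witness of the stability table otherwise). -/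
theorem cherry_fourth_best (k a r : ℕ) (ha3 : 3 ≤ a) (hr6 : 6 ≤ r) (hk : 2 * a + r ≤ k)
    (hk3 : a = 3 → r + 7 ≤ k) :
    (∀ (D : SimpleGraph (Fin k)) [DecidableRel D.Adj], K4mFree D → D.edgeFinset.card + r = a * (k - a) →
        ∑ v, deg D v * deg D v + r * (k - 1 - r) ≠ D.edgeFinset.card * k →
        ∑ v, deg D v * deg D v + r * (k - 1 - r) + 2 * (r - 2) ≠ D.edgeFinset.card * k →
        ∑ v, deg D v * deg D v + r * (k - 1 - r) + 2 * (r - 1) ≠ D.edgeFinset.card * k →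
        ∑ v, deg D v * deg D v + r * (k - 1 - r) + min (4 * (r - 3)) (stabGapFull k a r) ≤
          D.edgeFinset.card * k) ∧
      ∃ (D : SimpleGraph (Fin k)) (_ : DecidableRel D.Adj), K4mFree D ∧ D.edgeFinset.card + r = a * (k - a) ∧
        ∑ v, deg D v * deg D v + r * (k - 1 - r) + min (4 * (r - 3)) (stabGapFull k a r) =
          D.edgeFinset.card * k := by
  have hcard : Fintype.card (Fin k) = k := Fintype.card_fin k
  refine ⟨?_, ?_⟩
  · intro D _ hK hm hne1 hne2 hne3
    by_cases hbip : ∃ A : Finset (Fin k), A.card = a ∧ BipSub D A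
    · obtain ⟨A, hA, hB⟩ := hbip
      have ht := bipSub_gap_trichotomy D A hB a r hA (by rw [hcard]; exact hm) (by omega) (by rw [hcard]; omega)
      rw [hcard] at ht
      have hmin := min_le_left (4 * (r - 3)) (stabGapFull k a r)
      rcases ht with h | h | h | h
      · exact absurd h hne1
      · exact absurd h hne2
      · exact absurd h hne3
      · omega
    · have h := (stab_table_rows_ge_three k a r ha3 hk (by omega) hk3).1 D hK hm hbip
      have hmin := min_le_right (4 * (r - 3)) (stabGapFull k a r)
      omega
  · by_cases hle : 4 * (r - 3) ≤ stabGapFull k a r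
    · rw [min_eq_left hle]
      obtain ⟨hK, hE, hS⟩ := twoPairsAtLeaf_value k a r ha3 (by omega) (by omega) (by omega)
      exact ⟨twoPairsAtLeaf k a r (by omega) (by omega) (by omega), inferInstance, hK, hE, hS⟩
    · rw [min_eq_right (le_of_lt (not_le.mp hle))]
      obtain ⟨D, inst, hK, hE, -, hS⟩ := (stab_table_rows_ge_three k a r ha3 hk (by omega) hk3).2
      exact ⟨D, inst, hK, hE, hS⟩

end C047

end TriangleCap

end PercRepro
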